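import Summits.NavierStokesRegularity.NavierStokesRegularity.Theorems.PalasekTowerBreakdownEpisodeBaseGerm
import Summits.NavierStokesRegularity.FluidComputer.PalasekTowerGermHostTolerant

/-!
# `EpisodeBase` BY NAME for the TOLERANT germ slot: the widest door of record

Cell `ns-blowup`, seat `ns-blowup-ecbridge-3` (g3); GROUP C «BRIDGE SUPPORT» of the route
`PalasekTowerBreakdown`, crux `EpisodeBase` (item stmt-NavierStokesRegularity-19179, R2 of record:
`EpisodeBase ↔ ∃ S*, HostPreparationD (HostClass.exact S*) ∧ FirstEpisodeD (HostClass.exact S*)`).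
Sequel of `PalasekTowerBreakdownEpisodeBaseGerm.lean` (strict slot) for the TOLERANT slot
`Germ.LevelZeroDataTol c₄` of `FluidComputer/PalasekTowerGermHostTolerant.lean`: the three level-`0`
readouts plus the first-order test `⟪U, P(ΔU − (U·∇)U)⟫ > −c₄Y₀²/8` on the argmax of `‖U‖` (the push
`κ = c₄/2` of the register pays for a viscous decay of the speed maximum up to that rate; strict ⇒ weak
⇒ tolerant). LABEL: E–C typing (KERNEL, proofs only, by name). WHAT THIS IS NOT: not Navier–Stokes
evidence — conditionals whose hypothesis is the OPEN episode of a named design; nothing is asserted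
about any flow after `τ₀`, about `RungG 1` or blow-up. HELPER for 19179 (`--supports`), closes nothing.

* `palasekTowerBreakdown_hostPreparationD_tolerant`: `HostPreparationD (HostClass.exact S⋆(U, c₄))` for
  every tolerant-slot profile — the first conjunct of the R2 witness, no further hypothesis;
* `palasekTowerBreakdown_episodeBase_of_tolerant_firstEpisodeD`: `EpisodeBase ⇐ FirstEpisodeD (exact S⋆)`;
* `palasekTowerBreakdown_episodeBase_of_tolerant_levelWitness`: `EpisodeBase ⇐ S⋆.LevelWitness 1 0` —
  ONE classical finite-energy flow of `S⋆`'s forced system from rest reaching `τ₁` below `(5/3)Y₁` on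
  the window with the three level-`1` floors at `τ₁`;
* `palasekTowerBreakdown_episodeBase_of_exists_tolerant_firstEpisodeD`: the `∃`-packaged form over the
  slot (SOME profile, SOME `c₄ ∈ (0, 1]`, its episode).

References: S. Palasek, arXiv:2605.13827 §3.3, §4 (Step 2) [cite: Palasek2026ElementaryModel, §4];
H. Sohr, *The Navier–Stokes Equations* (2001), Ch. V Thm. 1.5.1 [cite: Sohr2001, Ch. V Thm. 1.5.1].
-/

noncomputable section

-- `Summit.<Summit>.<Problem>` is the tree's mandated summit-side namespace (CONVENTIONS §2); for this
-- single-conjunct summit the two coincide, so the duplicate is deliberate.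
set_option linter.dupNamespace false

namespace Summit.NavierStokesRegularity.NavierStokesRegularity.Theorems

open Set Function
open Summit.NavierStokesRegularity.FluidComputer.PalasekTowerClayBridge
open Summit.NavierStokesRegularity.FluidComputer.PalasekTowerClayBridge.Germ
open Literature.Analysis.FluidPDE

variable {c₄ : ℝ} {U : EuclideanSpace ℝ (Fin 3) → EuclideanSpace ℝ (Fin 3)} {ρ : ℝ}

/-- **HOST PREPARATION FOR EVERY TOLERANT-SLOT PROFILE** (first conjunct of the R2 witness): the pushed
germ schedule `S⋆(U, c₄)` is prepared in its singleton class. [cite: Palasek2026ElementaryModel, §3.3] -/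
theorem palasekTowerBreakdown_hostPreparationD_tolerant (h : LevelZeroDataTol c₄ U ρ) (hc₄ : 0 < c₄)
    (hc₄' : c₄ ≤ 1) : HostPreparationD (HostClass.exact (h.host hc₄ hc₄')) :=
  h.hostPreparationD_host hc₄ hc₄'

/-- **`EpisodeBase` from the EPISODE of a tolerant-slot design.** [cite: Palasek2026ElementaryModel, §4] -/
theorem palasekTowerBreakdown_episodeBase_of_tolerant_firstEpisodeD (h : LevelZeroDataTol c₄ U ρ)
    (hc₄ : 0 < c₄) (hc₄' : c₄ ≤ 1) (hF : FirstEpisodeD (HostClass.exact (h.host hc₄ hc₄'))) :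
    Summit.NavierStokesRegularity.NavierStokesRegularity.Theses.PalasekTowerBreakdown.EpisodeBase :=
  h.episodeBaseG_of_firstEpisodeD hc₄ hc₄' hF

/-- **`EpisodeBase` from ONE LEVEL WITNESS of a tolerant-slot design** (no re-push).
[cite: Sohr2001, Ch. V Thm. 1.5.1] -/
theorem palasekTowerBreakdown_episodeBase_of_tolerant_levelWitness (h : LevelZeroDataTol c₄ U ρ)
    (hc₄ : 0 < c₄) (hc₄' : c₄ ≤ 1) (hW : (h.host hc₄ hc₄').LevelWitness 1 0) :
    Summit.NavierStokesRegularity.NavierStokesRegularity.Theses.PalasekTowerBreakdown.EpisodeBase :=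
  palasekTowerBreakdown_episodeBase_of_tolerant_firstEpisodeD h hc₄ hc₄'
    (firstEpisodeD_exact_of_levelWitness_self (h.host_pins hc₄ hc₄') (h.host_rigid hc₄ hc₄')
      (h.host_quiet hc₄ hc₄') hW)

/-- **What remains of the crux over the tolerant slot, by name**: `EpisodeBase` holds as soon as SOME
profile in the tolerant slot, at SOME push constant `c₄ ∈ (0, 1]`, has its first episode.
[cite: Palasek2026ElementaryModel, §4] -/
theorem palasekTowerBreakdown_episodeBase_of_exists_tolerant_firstEpisodeD
    (hex : ∃ (c₄ : ℝ) (U : EuclideanSpace ℝ (Fin 3) → EuclideanSpace ℝ (Fin 3)) (ρ : ℝ)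
      (h : LevelZeroDataTol c₄ U ρ) (hc₄ : 0 < c₄) (hc₄' : c₄ ≤ 1),
        FirstEpisodeD (HostClass.exact (h.host hc₄ hc₄'))) :
    Summit.NavierStokesRegularity.NavierStokesRegularity.Theses.PalasekTowerBreakdown.EpisodeBase := by
  obtain ⟨c₄, U, ρ, h, hc₄, hc₄', hF⟩ := hex
  exact palasekTowerBreakdown_episodeBase_of_tolerant_firstEpisodeD h hc₄ hc₄' hF

end Summit.NavierStokesRegularity.NavierStokesRegularity.Theorems

end
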